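import Literature.AnabelianGeometry.AbsoluteAnabelian.AbsTopIThm26vProofs
import Literature.AnabelianGeometry.AbsoluteAnabelian.AbsTopIThm26Thm214RekeyedProofs
import Literature.AnabelianGeometry.AbsoluteAnabelian.AbsAnabFundamentalGroupsSchemaNegative
import Literature.AnabelianGeometry.AbsoluteAnabelian.AbsTopIProp23InfiniteIndexProofs
import HarnessLib

/-!
# [AbsTopI] Thm 2.6 (v), (vi) AS TYPED: instance forms PROVED at the point extensions `Π = G`
# (FACT-LIST F-0249 `FundamentalExtension.Thm26v`, F-0250 `FundamentalExtension.Thm26vi`)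

S. Mochizuki, *Topics in Absolute Anabelian Geometry I: Generalities*, J. Math. Sci. Univ. Tokyo 19 (2012)
[MochizukiAbsTopI2012], Thm 2.6 (v), (vi) p. 22 (manuscript pagination, lit key `paper:url-11ac98ba15fc`).

PROOF-ONLY companion (no definition, no instance, no named fact), abc-iut cell seat abc-iut-f-091, third
file on FACT-LIST rows **F-0249** / **F-0250** after `AbsTopISemiAbsoluteSchemaNegative.lean` (universal
closures REFUTED) and `AbsTopIThm26vSchemaNegativeTfg.lean` (refuted in the `Δ`-tfg regime).  Here the
complementary kernel event — the typed predicates HOLD at the DEGENERATE point extensions `Π = G ↠ G`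
(`Δ = 1`, i.e. "`X = Spec k`", which is NOT a hyperbolic orbicurve: a satisfiability / instance witness in
the sense of plan R5, exactly as abc-iut-f-090's `MLFBase.thm26iv_of_geom_eq_bot` / `thm26ii_of_geom_eq_bot`
for (ii), (iv)) — from theorems already in the tree, consumed BY NAME:

* `FundamentalExtension.splitsOverOpenSubgroup_of_geom_eq_bot` — an extension with `Δ = 1` splits (the
  augmentation is a continuous bijection of compact Hausdorff groups, hence a topological isomorphism);
* `FundamentalExtension.MLFBase.thm26v_of_geom_eq_bot` — **(v) for EVERY extension with MLF base data and
  `Δ = 1`**: by abc-iut-L4's `thm26v_of_starCondition` (its inputs: the splitting above, `Δ = 1` tfg, and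
  condition (∗) at `Δ'' = 1`, abc-iut-f-053's `starCondition_of_geom_eq_bot`) — ultimately the tree's local
  class field theory (`thm26_ii_delta_gal_holds`: `ζ(G_k) = [k : ℚ_p]`);
* `FundamentalExtension.NFBase.thm26vi_of_geom_eq_bot` — **(vi) for EVERY extension with NF base data and
  `Δ = 1`**: by `NFBase.thm26vi_of_invariantCharacters_trivial` ([AbsAnab] Thm 1.1.2 PROVED in the tree,
  `galoisNF_tfgNormalSubgroup_trivial_holds`; the Tate-module hypothesis `hT` is vacuous on `Δ = 1`);
* the closed instances `thm26v_absoluteGalois_padic` (`Π = G = G_{ℚ_p}`, base `(p, ℚ_p, refl)`, every `p`) and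
  `thm26vi_absoluteGalois_rat` (`Π = G = G_ℚ`, base `(ℚ, refl)`).

FACT-LIST reading for both rows: «universal closure REFUTED (abstract extensions); instance form PROVED at the
point extensions; geometric instances = the conditional forms `thm26v_of_coinvariantRankConstant` /
`thm26vi_of_tfgNormalSubgroup_trivial` (inputs: [AbsTopI] Prop 2.2, Thm 2.6 (ii), `T_l(A)/G = 0`)».
HONEST FRAMING: degenerate instances, labelled as such; nothing of [AbsTopI] is strengthened or disputed;
nothing here bears on the disputed [IUTchIII] Cor. 3.12 or takes a side; typed ≠ proved elsewhere.
-/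

noncomputable section

open Topology

universe u

namespace Literature.AnabelianGeometry.AbsoluteAnabelian

namespace FundamentalExtension

variable (E : FundamentalExtension.{u})

/-- If `Δ = 1` the augmentation `Π → G` is injective. [folklore] -/
private theorem aug_injective_of_geom_eq_bot (h : E.geom = ⊥) : Function.Injective E.aug := by
  intro x y hxy
  have hmem : x * y⁻¹ ∈ E.geom := by
    rw [E.mem_geom, map_mul, map_inv, hxy, mul_inv_cancel]
  rw [h, Subgroup.mem_bot] at hmem
  exact mul_inv_eq_one.mp hmem

/-- **An extension with `Δ = 1` splits** (over the open subgroup `G` itself): the augmentation `Π → G` is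
then a continuous bijective homomorphism of compact Hausdorff groups, hence an isomorphism of topological
groups, and its inverse is a continuous section. [cite: MochizukiAbsAnab2004, §1.1 p.7] -/
theorem splitsOverOpenSubgroup_of_geom_eq_bot (h : E.geom = ⊥) : E.SplitsOverOpenSubgroup := by
  have hbij : Function.Bijective E.aug := ⟨E.aug_injective_of_geom_eq_bot h, E.aug_surjective⟩
  -- the augmentation as a homeomorphism (compact source, Hausdorff target)
  let φ : E.arith ≃ₜ E.gal :=
    (map_continuous E.aug).homeoOfEquivCompactToT2 (f := Equiv.ofBijective E.aug hbij)
  -- its inverse as a continuous homomorphism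
  let m : E.arith ≃* E.gal := MulEquiv.ofBijective E.aug.toMonoidHom hbij
  let s : E.gal →ₜ* E.arith := ⟨m.symm.toMonoidHom, φ.symm.continuous⟩
  exact E.splitsOverOpenSubgroup_of_section s fun g => m.apply_symm_apply g

/-- If `Δ = 1`, every element of `Δ` (as a subtype) is `1`. [folklore] -/
private theorem coe_eq_one_of_geom_eq_bot (h : E.geom = ⊥) (d : E.geom) : (d : E.arith) = 1 := by
  have hd : (d : E.arith) ∈ (⊥ : Subgroup E.arith) := by
    rw [← h]
    exact d.2
  exact Subgroup.mem_bot.mp hd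

/-- If `Δ = 1` then `Δ` is topologically finitely generated (it is finite). [folklore] -/
private theorem geomTFG_of_geom_eq_bot (h : E.geom = ⊥) : E.GeomTFG := by
  haveI : Subsingleton E.geom := ⟨fun a b => Subtype.ext
    ((E.coe_eq_one_of_geom_eq_bot h a).trans (E.coe_eq_one_of_geom_eq_bot h b).symm)⟩
  exact isTopologicallyFinitelyGenerated_of_finite

/-- **[AbsTopI] Thm 2.6 (v) AS TYPED holds for EVERY extension with MLF base data and `Δ = 1`** (the
point extension `Π = G ≅ G_k`, "`X = Spec k`" — DEGENERATE instance): `ζ(Π) = ζ(G_k) = [k : ℚ_p]` and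
`Δ = 1 = ⋂ {H open | ζ(H) = [Π : H]·ζ(Π)}` (every open `H ≅ G_{k'}` qualifies, `ζ(G_{k'}) = [k' : ℚ_p]`).
Obtained from abc-iut-L4's `thm26v_of_starCondition`: the extension splits
(`splitsOverOpenSubgroup_of_geom_eq_bot`), `Δ = 1` is tfg, and (∗) holds with `Δ'' = 1`
(`starCondition_of_geom_eq_bot`); the ranks are the tree's local class field theory.
[cite: MochizukiAbsTopI2012, Thm 2.6 (v) p.22] -/
theorem MLFBase.thm26v_of_geom_eq_bot {E : FundamentalExtension.{0}} (B : E.MLFBase) (h : E.geom = ⊥) :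
    E.Thm26v B :=
  E.thm26v_of_starCondition B (E.splitsOverOpenSubgroup_of_geom_eq_bot h) (E.geomTFG_of_geom_eq_bot h)
    (E.starCondition_of_geom_eq_bot h)

/-- **[AbsTopI] Thm 2.6 (vi) AS TYPED holds for EVERY extension with NF base data and `Δ = 1`** (the point
extension `Π = G ≅ G_F` — DEGENERATE instance): every continuous `Π → ℤ_l` kills `Δ = 1`; `Δ = 1` is the
maximal topologically finitely generated closed normal subgroup of `Π ≅ G_F` ([AbsAnab] Thm 1.1.2, PROVED in
the tree); `Π ≅ G_F` is not topologically finitely generated.  Via `NFBase.thm26vi_of_invariantCharacters_trivial`,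
whose Tate-module hypothesis is vacuous on `Δ = 1`. [cite: MochizukiAbsTopI2012, Thm 2.6 (vi) p.22] -/
theorem NFBase.thm26vi_of_geom_eq_bot {E : FundamentalExtension.{0}} (B : E.NFBase) (h : E.geom = ⊥) :
    E.Thm26vi := by
  refine NFBase.thm26vi_of_invariantCharacters_trivial B (E.geomTFG_of_geom_eq_bot h) fun l _ ψ _ d => ?_
  have hd : d = 1 := Subtype.ext (E.coe_eq_one_of_geom_eq_bot h d)
  rw [hd, map_one]

/-! ### The closed instances `Π = G = G_{ℚ_p}` and `Π = G = G_ℚ` -/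

/-- For the identity extension `id : A ⟶ A` the geometric subgroup is trivial. [folklore] -/
private theorem geom_idExt_eq_bot (A : ProfiniteGrp.{0}) :
    (⟨A, A, ContinuousMonoidHom.id _, Function.surjective_id⟩ : FundamentalExtension.{0}).geom = ⊥ := by
  ext x
  exact ⟨fun hx => Subgroup.mem_bot.mpr ((mem_geom _).mp hx),
    fun hx => (mem_geom _).mpr (Subgroup.mem_bot.mp hx)⟩

/-- **F-0249, closed instance**: the typed Thm 2.6 (v) HOLDS for the point extension `Π = G = G_{ℚ_p}`,
`aug = id`, with MLF base data `(p, ℚ_p, refl)` — for every prime `p` (DEGENERATE: `X = Spec ℚ_p`).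
[cite: MochizukiAbsTopI2012, Thm 2.6 (v) p.22] -/
theorem thm26v_absoluteGalois_padic (p : ℕ) [Fact p.Prime] :
    (⟨absoluteGaloisGrp ℚ_[p], absoluteGaloisGrp ℚ_[p], ContinuousMonoidHom.id _, Function.surjective_id⟩ :
      FundamentalExtension.{0}).Thm26v { p := p, K := ℚ_[p], galIso := ContinuousMulEquiv.refl _ } :=
  MLFBase.thm26v_of_geom_eq_bot _ (geom_idExt_eq_bot (absoluteGaloisGrp ℚ_[p]))

/-- **F-0250, closed instance**: the typed Thm 2.6 (vi) HOLDS for the point extension `Π = G = G_ℚ`,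
`aug = id`, with NF base data `(ℚ, refl)` (DEGENERATE: `X = Spec ℚ`).
[cite: MochizukiAbsTopI2012, Thm 2.6 (vi) p.22] -/
theorem thm26vi_absoluteGalois_rat :
    (⟨absoluteGaloisGrp ℚ, absoluteGaloisGrp ℚ, ContinuousMonoidHom.id _, Function.surjective_id⟩ :
      FundamentalExtension.{0}).Thm26vi :=
  NFBase.thm26vi_of_geom_eq_bot { F := ℚ, galIso := ContinuousMulEquiv.refl _ }
    (geom_idExt_eq_bot (absoluteGaloisGrp ℚ))

end FundamentalExtension

end Literature.AnabelianGeometry.AbsoluteAnabelian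

end
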